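import Mathlib
import HarnessLib
import Literature.RepresentationTheory.CompactGroups.UnitaryTrick
import Literature.MathematicalPhysics.QuantumFieldTheory.Sweep1
import Summits.QuantumFields.YangMills.Theorems.PencilRigidityCurvatureKernelBoundSwapReflectionPositivityGeometry

/-!
# `CurvatureKernelBound` — stub `SwapReflectionPositivity` (F2), part 2/4: the action split

Support file for crux `stmt-QuantumFields-11687`, line `coupling-trichotomy`, stub
`SwapReflectionPositivity` (diagonal-mirror reflection positivity of the free-boundary Wilson measure
on `{-L,…,L}⁴`; FILS 1978 Thm. 2.1, Osterwalder–Seiler 1978 §2). This part: the reflected configuration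
`(ΘU)(x, k) = U(x ∘ swap i j, swap i j k)` and plaquette holonomies (`(ΘU)_{x,k,l} = U_{θx,σk,σl}`),
the split `∑_{p ⊆ Λ} Re tr ρ(U_p) = A(U) + A(ΘU) + S_M(U) + X(U)` into positive, reflected positive,
mirror and cut parts, the cut identity `U_{y,i,j} = V₊(U) V₊(ΘU)⁻¹` (`V₊ = U(y,i) U(y+eᵢ,j)`) making
`β X(U)` a Gram kernel `∑ aᵢ(U) conj aᵢ(ΘU)` in the unitarised representation, and the pointwise
identity `F(U) F(ΘU) e^{-βS_Λ(U)} = e^{-βN#Λ'} g(U) conj g(ΘU) exp(∑ aᵢ(U) conj aᵢ(ΘU))` with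
`g = F e^{βA + βS_M/2}` (for `i < j`, `β ≥ 0`). Helpers in the sub-namespace `SwapRP`. [folklore]
-/

noncomputable section

open MeasureTheory
open scoped ComplexConjugate ComplexOrder
open Literature.MathematicalPhysics.QuantumFieldTheory Literature.Probability.LatticeModels

namespace Summit.QuantumFields.YangMills.Theorems.CurvatureKernel

namespace SwapRP

/-! ## The reflected configuration `(ΘU)(e) = U(θ e)` and plaquette holonomies -/

section Holonomy

variable {G : Type*} [Group G] {i j : Fin 4}

/-- `(ΘU)_{x,k,l} = U_{θx, σk, σl}`: the holonomy of the reflected configuration around a plaquette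
is the holonomy around the reflected (possibly reversed) plaquette. [folklore] -/
theorem plaquette_swapCfg (i j : Fin 4) (U : ZdGaugeConfig 4 G) (x : Site 4) (k l : Fin 4) :
    ZdGaugeConfig.plaquette (fun e : Site 4 × Fin 4 => U (e.1 ∘ Equiv.swap i j, Equiv.swap i j e.2))
        x k l =
      ZdGaugeConfig.plaquette U (x ∘ Equiv.swap i j) (Equiv.swap i j k) (Equiv.swap i j l) := by
  simp only [ZdGaugeConfig.plaquette, add_single_comp_swap]

/-- Reversing the plane pair inverts the plaquette holonomy. [folklore] -/
theorem plaquette_swap_plane (U : ZdGaugeConfig 4 G) (x : Site 4) (k l : Fin 4) :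
    ZdGaugeConfig.plaquette U x l k = (ZdGaugeConfig.plaquette U x k l)⁻¹ := by
  simp only [ZdGaugeConfig.plaquette, mul_inv_rev, inv_inv, mul_assoc]

/-- The holonomy of a cut plaquette `(y, i, j)`, `y i = y j`, is `V₊(U) · V₊(ΘU)⁻¹` with the
half plaquette `V₊(U) = U(y, i) U(y + e_i, j)` (a path in the closed positive half). [folklore] -/
theorem plaquette_cut_eq (U : ZdGaugeConfig 4 G) {y : Site 4} (hy : y i = y j) :
    ZdGaugeConfig.plaquette U y i j = (U (y, i) * U (y + Pi.single i 1, j)) * ((((fun e : Site 4 ×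
        Fin 4 => U (e.1 ∘ Equiv.swap i j, Equiv.swap i j e.2))) (y, i) * ((fun e : Site 4 × Fin 4 =>
        U (e.1 ∘ Equiv.swap i j, Equiv.swap i j e.2))) (y + Pi.single i 1, j)))⁻¹ := by
  have h1 : (((fun e : Site 4 × Fin 4 => U (e.1 ∘ Equiv.swap i j, Equiv.swap i j e.2))) (y, i) *
      ((fun e : Site 4 × Fin 4 => U (e.1 ∘ Equiv.swap i j, Equiv.swap i j e.2))) (y + Pi.single i 1,
      j)) = U (y, j) * U (y + Pi.single j 1, i) := by
    simp only [add_single_comp_swap, Equiv.swap_apply_left, Equiv.swap_apply_right,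
      comp_swap_of_apply_eq hy]
  rw [h1]
  simp only [ZdGaugeConfig.plaquette, mul_inv_rev, mul_assoc]

omit [Group G] in
/-- A function of the links in `B`, composed with `Θ`, is a function of the links in `θB`.
[folklore] -/
theorem dependsOn_comp_swapCfg (i j : Fin 4) {α : Type*} {F : ZdGaugeConfig 4 G → α}
    {B : Finset (Site 4 × Fin 4)} (hF : DependsOn F (B : Set (Site 4 × Fin 4))) :
    DependsOn (fun U : ZdGaugeConfig 4 G => F (fun e : Site 4 × Fin 4 => U (e.1 ∘ Equiv.swap i j,
        Equiv.swap i j e.2)))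
      ((B.image (fun e : Site 4 × Fin 4 => (e.1 ∘ Equiv.swap i j, Equiv.swap i j e.2)) : Finset
          (Site 4 × Fin 4)) : Set (Site 4 × Fin 4)) := by
  intro U V hUV
  apply hF
  intro e he
  exact hUV _ (Finset.mem_coe.2 (Finset.mem_image_of_mem _ (Finset.mem_coe.1 he)))

end Holonomy

/-! ## The Wilson action of the box split along the mirror -/

section Action

variable {G : Type*} [Group G] [TopologicalSpace G] [IsTopologicalGroup G] [CompactSpace G]
variable {N : ℕ} (ρ : G →* Matrix (Fin N) (Fin N) ℂ) {i j : Fin 4}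

/-- `Re tr ρ((ΘU)_p) = Re tr ρ(U_{θp})` for the re-sorted reflected plaquette `θp` (characters of
compact groups are real on inverses). [folklore] -/
theorem re_tr_plaquette_swapCfg (hρ : Continuous ρ) (U : ZdGaugeConfig 4 G) (p : Site 4 × Fin 4 ×
    Fin 4) :
    (ρ (ZdGaugeConfig.plaquette ((fun e : Site 4 × Fin 4 => U (e.1 ∘ Equiv.swap i j, Equiv.swap i j
        e.2))) p.1 p.2.1 p.2.2)).trace.re = (ρ (ZdGaugeConfig.plaquette U ((if Equiv.swap i j p.2.1
        < Equiv.swap i j p.2.2 then (p.1 ∘ Equiv.swap i j, Equiv.swap i j p.2.1, Equiv.swap i j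
        p.2.2) else (p.1 ∘ Equiv.swap i j, Equiv.swap i j p.2.2, Equiv.swap i j p.2.1) : Site 4 ×
        Fin 4 × Fin 4)).1 ((if Equiv.swap i j p.2.1 < Equiv.swap i j p.2.2 then (p.1 ∘ Equiv.swap i
        j, Equiv.swap i j p.2.1, Equiv.swap i j p.2.2) else (p.1 ∘ Equiv.swap i j, Equiv.swap i j
        p.2.2, Equiv.swap i j p.2.1) : Site 4 × Fin 4 × Fin 4)).2.1 ((if Equiv.swap i j p.2.1 <
        Equiv.swap i j p.2.2 then (p.1 ∘ Equiv.swap i j, Equiv.swap i j p.2.1, Equiv.swap i j p.2.2)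
        else (p.1 ∘ Equiv.swap i j, Equiv.swap i j p.2.2, Equiv.swap i j p.2.1) : Site 4 × Fin 4 ×
        Fin 4)).2.2)).trace.re := by
  obtain ⟨x, k, l⟩ := p
  dsimp only
  rw [plaquette_swapCfg]
  by_cases h : Equiv.swap i j k < Equiv.swap i j l
  · simp only [h, ↓reduceIte]
  · simp only [h, ↓reduceIte]
    rw [plaquette_swap_plane U _ (Equiv.swap i j k) (Equiv.swap i j l),
      Literature.RepresentationTheory.CompactGroups.CompactGroup.re_trace_map_inv ρ hρ]

/-- The negative part of the action is the positive part of the reflected configuration (the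
reflection is a bijection from positive to negative plaquettes of the box). [folklore] -/
theorem sum_neg_eq_apos_swapCfg (hρ : Continuous ρ) (L : ℕ) (U : ZdGaugeConfig 4 G) :
    (∑ p ∈ (plaquettesIn (box 4 L)).filter (fun p : Site 4 × Fin 4 × Fin 4 => ((p.1 i ≤ p.1 j ∧ (p.1
        + Pi.single p.2.1 1 : Site 4) i ≤ (p.1 + Pi.single p.2.1 1 : Site 4) j ∧ (p.1 + Pi.single
        p.2.2 1 : Site 4) i ≤ (p.1 + Pi.single p.2.2 1 : Site 4) j ∧ (p.1 + Pi.single p.2.1 1 +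
        Pi.single p.2.2 1 : Site 4) i ≤ (p.1 + Pi.single p.2.1 1 + Pi.single p.2.2 1 : Site 4) j) ∧
        ¬ (p.1 i = p.1 j ∧ (p.1 + Pi.single p.2.1 1 : Site 4) i = (p.1 + Pi.single p.2.1 1 : Site 4)
        j ∧ (p.1 + Pi.single p.2.2 1 : Site 4) i = (p.1 + Pi.single p.2.2 1 : Site 4) j))), (ρ
        (ZdGaugeConfig.plaquette U p.1 p.2.1 p.2.2)).trace.re) = (∑ p ∈ (plaquettesIn (box 4
        L)).filter (fun p : Site 4 × Fin 4 × Fin 4 => ((p.1 j ≤ p.1 i ∧ (p.1 + Pi.single p.2.1 1 :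
        Site 4) j ≤ (p.1 + Pi.single p.2.1 1 : Site 4) i ∧ (p.1 + Pi.single p.2.2 1 : Site 4) j ≤
        (p.1 + Pi.single p.2.2 1 : Site 4) i ∧ (p.1 + Pi.single p.2.1 1 + Pi.single p.2.2 1 : Site
        4) j ≤ (p.1 + Pi.single p.2.1 1 + Pi.single p.2.2 1 : Site 4) i) ∧ ¬ (p.1 i = p.1 j ∧ (p.1 +
        Pi.single p.2.1 1 : Site 4) i = (p.1 + Pi.single p.2.1 1 : Site 4) j ∧ (p.1 + Pi.single
        p.2.2 1 : Site 4) i = (p.1 + Pi.single p.2.2 1 : Site 4) j))), (ρ (ZdGaugeConfig.plaquette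
        ((fun e : Site 4 × Fin 4 => U (e.1 ∘ Equiv.swap i j, Equiv.swap i j e.2))) p.1 p.2.1
        p.2.2)).trace.re) := by
  symm
  refine Finset.sum_nbij' (fun p : Site 4 × Fin 4 × Fin 4 => (if Equiv.swap i j p.2.1 < Equiv.swap i
      j p.2.2 then (p.1 ∘ Equiv.swap i j, Equiv.swap i j p.2.1, Equiv.swap i j p.2.2) else (p.1 ∘
      Equiv.swap i j, Equiv.swap i j p.2.2, Equiv.swap i j p.2.1) : Site 4 × Fin 4 × Fin 4)) (fun p
      : Site 4 × Fin 4 × Fin 4 => (if Equiv.swap i j p.2.1 < Equiv.swap i j p.2.2 then (p.1 ∘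
      Equiv.swap i j, Equiv.swap i j p.2.1, Equiv.swap i j p.2.2) else (p.1 ∘ Equiv.swap i j,
      Equiv.swap i j p.2.2, Equiv.swap i j p.2.1) : Site 4 × Fin 4 × Fin 4))
    ?_ ?_ ?_ ?_ ?_
  · intro p hp
    rw [Finset.mem_filter] at hp ⊢
    refine ⟨reflPlaq_mem_plaquettesIn i j hp.1, ?_⟩
    obtain ⟨x, k, l⟩ := p
    have h2 := hp.2
    by_cases h : Equiv.swap i j k < Equiv.swap i j l <;>
      simp only [h, ↓reduceIte, Function.comp_apply, Pi.add_apply, Equiv.swap_apply_left,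
        Equiv.swap_apply_right, single_swap_apply_left, single_swap_apply_right] at h2 ⊢ <;> omega
  · intro p hp
    rw [Finset.mem_filter] at hp ⊢
    refine ⟨reflPlaq_mem_plaquettesIn i j hp.1, ?_⟩
    obtain ⟨x, k, l⟩ := p
    have h2 := hp.2
    by_cases h : Equiv.swap i j k < Equiv.swap i j l <;>
      simp only [h, ↓reduceIte, Function.comp_apply, Pi.add_apply, Equiv.swap_apply_left,
        Equiv.swap_apply_right, single_swap_apply_left, single_swap_apply_right] at h2 ⊢ <;> omega
  · intro p hp
    exact reflPlaq_reflPlaq i j (mem_plaquettesIn_iff.1 (Finset.mem_filter.1 hp).1).2.1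
  · intro p hp
    exact reflPlaq_reflPlaq i j (mem_plaquettesIn_iff.1 (Finset.mem_filter.1 hp).1).2.1
  · intro p _
    exact re_tr_plaquette_swapCfg ρ hρ U p

/-- `∑_p Re tr ρ(U_p) = A(U) + A(ΘU) + S_M(U) + X(U)`: positive part, reflected positive part,
mirror part and cut part of the action of the box. [folklore] -/
theorem sum_plaqRe_split (hij : i < j) (hρ : Continuous ρ) (L : ℕ) (U : ZdGaugeConfig 4 G) :
    ∑ p ∈ plaquettesIn (box 4 L), (ρ (ZdGaugeConfig.plaquette U p.1 p.2.1 p.2.2)).trace.re = (∑ p ∈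
        (plaquettesIn (box 4 L)).filter (fun p : Site 4 × Fin 4 × Fin 4 => ((p.1 j ≤ p.1 i ∧ (p.1 +
        Pi.single p.2.1 1 : Site 4) j ≤ (p.1 + Pi.single p.2.1 1 : Site 4) i ∧ (p.1 + Pi.single
        p.2.2 1 : Site 4) j ≤ (p.1 + Pi.single p.2.2 1 : Site 4) i ∧ (p.1 + Pi.single p.2.1 1 +
        Pi.single p.2.2 1 : Site 4) j ≤ (p.1 + Pi.single p.2.1 1 + Pi.single p.2.2 1 : Site 4) i) ∧
        ¬ (p.1 i = p.1 j ∧ (p.1 + Pi.single p.2.1 1 : Site 4) i = (p.1 + Pi.single p.2.1 1 : Site 4)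
        j ∧ (p.1 + Pi.single p.2.2 1 : Site 4) i = (p.1 + Pi.single p.2.2 1 : Site 4) j))), (ρ
        (ZdGaugeConfig.plaquette U p.1 p.2.1 p.2.2)).trace.re) + (∑ p ∈ (plaquettesIn (box 4
        L)).filter (fun p : Site 4 × Fin 4 × Fin 4 => ((p.1 j ≤ p.1 i ∧ (p.1 + Pi.single p.2.1 1 :
        Site 4) j ≤ (p.1 + Pi.single p.2.1 1 : Site 4) i ∧ (p.1 + Pi.single p.2.2 1 : Site 4) j ≤
        (p.1 + Pi.single p.2.2 1 : Site 4) i ∧ (p.1 + Pi.single p.2.1 1 + Pi.single p.2.2 1 : Site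
        4) j ≤ (p.1 + Pi.single p.2.1 1 + Pi.single p.2.2 1 : Site 4) i) ∧ ¬ (p.1 i = p.1 j ∧ (p.1 +
        Pi.single p.2.1 1 : Site 4) i = (p.1 + Pi.single p.2.1 1 : Site 4) j ∧ (p.1 + Pi.single
        p.2.2 1 : Site 4) i = (p.1 + Pi.single p.2.2 1 : Site 4) j))), (ρ (ZdGaugeConfig.plaquette
        ((fun e : Site 4 × Fin 4 => U (e.1 ∘ Equiv.swap i j, Equiv.swap i j e.2))) p.1 p.2.1
        p.2.2)).trace.re) + (∑ p ∈ (plaquettesIn (box 4 L)).filter (fun p : Site 4 × Fin 4 × Fin 4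
        => (p.1 i = p.1 j ∧ (p.1 + Pi.single p.2.1 1 : Site 4) i = (p.1 + Pi.single p.2.1 1 : Site
        4) j ∧ (p.1 + Pi.single p.2.2 1 : Site 4) i = (p.1 + Pi.single p.2.2 1 : Site 4) j)), (ρ
        (ZdGaugeConfig.plaquette U p.1 p.2.1 p.2.2)).trace.re) + (∑ p ∈ (plaquettesIn (box 4
        L)).filter (fun p : Site 4 × Fin 4 × Fin 4 => (p.2.1 = i ∧ p.2.2 = j ∧ p.1 i = p.1 j)), (ρ
        (ZdGaugeConfig.plaquette U p.1 p.2.1 p.2.2)).trace.re) := by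
  rw [← sum_neg_eq_apos_swapCfg ρ hρ L U]
  exact sum_split_four (plaquettesIn (box 4 L)) (fun p : Site 4 × Fin 4 × Fin 4 => (ρ
      (ZdGaugeConfig.plaquette U p.1 p.2.1 p.2.2)).trace.re)
    (fun p : Site 4 × Fin 4 × Fin 4 => ((p.1 j ≤ p.1 i ∧ (p.1 + Pi.single p.2.1 1 : Site 4) j ≤ (p.1
        + Pi.single p.2.1 1 : Site 4) i ∧ (p.1 + Pi.single p.2.2 1 : Site 4) j ≤ (p.1 + Pi.single
        p.2.2 1 : Site 4) i ∧ (p.1 + Pi.single p.2.1 1 + Pi.single p.2.2 1 : Site 4) j ≤ (p.1 +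
        Pi.single p.2.1 1 + Pi.single p.2.2 1 : Site 4) i) ∧ ¬ (p.1 i = p.1 j ∧ (p.1 + Pi.single
        p.2.1 1 : Site 4) i = (p.1 + Pi.single p.2.1 1 : Site 4) j ∧ (p.1 + Pi.single p.2.2 1 : Site
        4) i = (p.1 + Pi.single p.2.2 1 : Site 4) j))) (fun p : Site 4 × Fin 4 × Fin 4 => ((p.1 i ≤
        p.1 j ∧ (p.1 + Pi.single p.2.1 1 : Site 4) i ≤ (p.1 + Pi.single p.2.1 1 : Site 4) j ∧ (p.1 +
        Pi.single p.2.2 1 : Site 4) i ≤ (p.1 + Pi.single p.2.2 1 : Site 4) j ∧ (p.1 + Pi.single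
        p.2.1 1 + Pi.single p.2.2 1 : Site 4) i ≤ (p.1 + Pi.single p.2.1 1 + Pi.single p.2.2 1 :
        Site 4) j) ∧ ¬ (p.1 i = p.1 j ∧ (p.1 + Pi.single p.2.1 1 : Site 4) i = (p.1 + Pi.single
        p.2.1 1 : Site 4) j ∧ (p.1 + Pi.single p.2.2 1 : Site 4) i = (p.1 + Pi.single p.2.2 1 : Site
        4) j)))
    (fun p : Site 4 × Fin 4 × Fin 4 => (p.1 i = p.1 j ∧ (p.1 + Pi.single p.2.1 1 : Site 4) i = (p.1
        + Pi.single p.2.1 1 : Site 4) j ∧ (p.1 + Pi.single p.2.2 1 : Site 4) i = (p.1 + Pi.single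
        p.2.2 1 : Site 4) j)) (fun p : Site 4 × Fin 4 × Fin 4 => (p.2.1 = i ∧ p.2.2 = j ∧ p.1 i =
        p.1 j))
    (fun p hp => plaq_class_cases hij (mem_plaquettesIn_iff.1 hp).2.1) (fun p hp => not_pos_of_neg
        hp)
    (fun p hm hp => hp.2 hm) (fun p hm hn => hn.2 hm) (fun p hp => not_pos_neg_mir_of_cut hij.ne hp)

/-- The mirror part of the action is reflection invariant. [folklore] -/
theorem smir_swapCfg (hij : i < j) (hρ : Continuous ρ) (L : ℕ) (U : ZdGaugeConfig 4 G) :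
    (∑ p ∈ (plaquettesIn (box 4 L)).filter (fun p : Site 4 × Fin 4 × Fin 4 => (p.1 i = p.1 j ∧ (p.1
        + Pi.single p.2.1 1 : Site 4) i = (p.1 + Pi.single p.2.1 1 : Site 4) j ∧ (p.1 + Pi.single
        p.2.2 1 : Site 4) i = (p.1 + Pi.single p.2.2 1 : Site 4) j)), (ρ (ZdGaugeConfig.plaquette
        ((fun e : Site 4 × Fin 4 => U (e.1 ∘ Equiv.swap i j, Equiv.swap i j e.2))) p.1 p.2.1
        p.2.2)).trace.re) = (∑ p ∈ (plaquettesIn (box 4 L)).filter (fun p : Site 4 × Fin 4 × Fin 4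
        => (p.1 i = p.1 j ∧ (p.1 + Pi.single p.2.1 1 : Site 4) i = (p.1 + Pi.single p.2.1 1 : Site
        4) j ∧ (p.1 + Pi.single p.2.2 1 : Site 4) i = (p.1 + Pi.single p.2.2 1 : Site 4) j)), (ρ
        (ZdGaugeConfig.plaquette U p.1 p.2.1 p.2.2)).trace.re) := by
  refine Finset.sum_congr rfl fun p hp => ?_
  rw [Finset.mem_filter] at hp
  rw [re_tr_plaquette_swapCfg ρ hρ U p, reflPlaq_of_mir hij (mem_plaquettesIn_iff.1 hp.1).2.1 hp.2]

omit [TopologicalSpace G] [IsTopologicalGroup G] [CompactSpace G] in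
/-- `S_Λ(U) = N · #Λ' - ∑_p Re tr ρ(U_p)`. [folklore] -/
theorem zdWilsonAction_box_eq (L : ℕ) (U : ZdGaugeConfig 4 G) :
    zdWilsonAction ρ (box 4 L) U =
      (N : ℝ) * (plaquettesIn (box 4 L)).card - ∑ p ∈ plaquettesIn (box 4 L), (ρ
          (ZdGaugeConfig.plaquette U p.1 p.2.1 p.2.2)).trace.re := by
  simp only [zdWilsonAction, Finset.sum_sub_distrib, Finset.sum_const, nsmul_eq_mul]
  ring

/-- **The cut identity.** `Re tr ρ(U_p) = ∑_{a,b} Re (σ(V₊(U))_{ab} conj σ(V₊(ΘU))_{ab})` for a cut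
plaquette `p = (y, i, j)`, `y i = y j`, `σ` the unitarised representation. [folklore] -/
theorem re_tr_plaquette_cut (hρ : Continuous ρ) (U : ZdGaugeConfig 4 G) {y : Site 4} (hy : y i = y
    j) :
    (ρ (ZdGaugeConfig.plaquette U y i j)).trace.re =
      ∑ a, ∑ b, (Literature.RepresentationTheory.CompactGroups.CompactGroup.unitarize ρ hρ (U (y, i)
          * U (y + Pi.single i 1, j)) a b * conj
          (Literature.RepresentationTheory.CompactGroups.CompactGroup.unitarize ρ hρ (((fun e : Site
          4 × Fin 4 => U (e.1 ∘ Equiv.swap i j, Equiv.swap i j e.2))) (y, i) * ((fun e : Site 4 ×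
          Fin 4 => U (e.1 ∘ Equiv.swap i j, Equiv.swap i j e.2))) (y + Pi.single i 1, j)) a b)).re
          := by
  rw [plaquette_cut_eq U hy]
  exact Literature.RepresentationTheory.CompactGroups.CompactGroup.re_trace_mul_inv_eq_sum ρ hρ _ _

/-- **The cut Boltzmann weight is a Gram kernel**: `∑ᵢ aᵢ(U) conj aᵢ(ΘU) = β X(U)` with the
coefficient functions `√(β/2) σ(V₊)_{ab}`, `√(β/2) conj σ(V₊)_{ab}` of the cut plaquettes. [folklore] -/
theorem sum_acoef_mul_conj (hρ : Continuous ρ) {β : ℝ} (hβ : 0 ≤ β) (L : ℕ) (U : ZdGaugeConfig 4 G)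
    :
    ∑ idx : (↥((plaquettesIn (box 4 L)).filter (fun p : Site 4 × Fin 4 × Fin 4 => (p.2.1 = i ∧ p.2.2
        = j ∧ p.1 i = p.1 j))) × Fin N × Fin N × Bool), ((Real.sqrt (β / 2) : ℂ) * (if idx.2.2.2
        then Literature.RepresentationTheory.CompactGroups.CompactGroup.unitarize ρ hρ (U
        (idx.1.1.1, i) * U (idx.1.1.1 + Pi.single i 1, j)) idx.2.1 idx.2.2.1 else conj
        (Literature.RepresentationTheory.CompactGroups.CompactGroup.unitarize ρ hρ (U (idx.1.1.1, i)
        * U (idx.1.1.1 + Pi.single i 1, j)) idx.2.1 idx.2.2.1))) * conj (((Real.sqrt (β / 2) : ℂ) *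
        (if idx.2.2.2 then Literature.RepresentationTheory.CompactGroups.CompactGroup.unitarize ρ hρ
        (((fun e : Site 4 × Fin 4 => U (e.1 ∘ Equiv.swap i j, Equiv.swap i j e.2))) (idx.1.1.1, i) *
        ((fun e : Site 4 × Fin 4 => U (e.1 ∘ Equiv.swap i j, Equiv.swap i j e.2))) (idx.1.1.1 +
        Pi.single i 1, j)) idx.2.1 idx.2.2.1 else conj
        (Literature.RepresentationTheory.CompactGroups.CompactGroup.unitarize ρ hρ (((fun e : Site 4
        × Fin 4 => U (e.1 ∘ Equiv.swap i j, Equiv.swap i j e.2))) (idx.1.1.1, i) * ((fun e : Site 4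
        × Fin 4 => U (e.1 ∘ Equiv.swap i j, Equiv.swap i j e.2))) (idx.1.1.1 + Pi.single i 1, j))
        idx.2.1 idx.2.2.1)))) = ((β * (∑ p ∈ (plaquettesIn (box 4 L)).filter (fun p : Site 4 × Fin 4
        × Fin 4 => (p.2.1 = i ∧ p.2.2 = j ∧ p.1 i = p.1 j)), (ρ (ZdGaugeConfig.plaquette U p.1 p.2.1
        p.2.2)).trace.re) : ℝ) : ℂ) := by
  have hs : (Real.sqrt (β / 2) : ℂ) * (Real.sqrt (β / 2) : ℂ) = ((β / 2 : ℝ) : ℂ) := by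
    rw [← Complex.ofReal_mul, Real.mul_self_sqrt (by linarith)]
  rw [Fintype.sum_prod_type, Finset.mul_sum, Complex.ofReal_sum, ← Finset.sum_coe_sort
      ((plaquettesIn (box 4 L)).filter (fun p : Site 4 × Fin 4 × Fin 4 => (p.2.1 = i ∧ p.2.2 = j ∧
      p.1 i = p.1 j)))]
  refine Finset.sum_congr rfl fun q _ => ?_
  obtain ⟨⟨x, k, l⟩, hq⟩ := q
  obtain ⟨hk, hl, hx⟩ := (Finset.mem_filter.1 hq).2
  dsimp only at hk hl hx ⊢
  have hR : (ρ (ZdGaugeConfig.plaquette U ((x, k, l)).1 ((x, k, l)).2.1 ((x, k, l)).2.2)).trace.re =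
      (ρ (ZdGaugeConfig.plaquette U x i j)).trace.re := by
    rw [hk, hl]
  rw [hR, re_tr_plaquette_cut ρ hρ U hx, Finset.mul_sum, Complex.ofReal_sum, Fintype.sum_prod_type]
  refine Finset.sum_congr rfl fun a _ => ?_
  rw [Finset.mul_sum, Complex.ofReal_sum, Fintype.sum_prod_type]
  refine Finset.sum_congr rfl fun b _ => ?_
  rw [Fintype.sum_bool]
  simp only [↓reduceIte, Bool.false_eq_true, map_mul (starRingEnd ℂ), Complex.conj_ofReal,
    Complex.conj_conj]
  set u := Literature.RepresentationTheory.CompactGroups.CompactGroup.unitarize ρ hρ (U (x, i) * U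
      (x + Pi.single i 1, j)) a b
  set v := Literature.RepresentationTheory.CompactGroups.CompactGroup.unitarize ρ hρ (((fun e : Site
      4 × Fin 4 => U (e.1 ∘ Equiv.swap i j, Equiv.swap i j e.2))) (x, i) * ((fun e : Site 4 × Fin 4
      => U (e.1 ∘ Equiv.swap i j, Equiv.swap i j e.2))) (x + Pi.single i 1, j)) a b
  calc (Real.sqrt (β / 2) : ℂ) * u * ((Real.sqrt (β / 2) : ℂ) * conj v) +
        (Real.sqrt (β / 2) : ℂ) * conj u * ((Real.sqrt (β / 2) : ℂ) * v)
      = ((Real.sqrt (β / 2) : ℂ) * (Real.sqrt (β / 2) : ℂ)) * (u * conj v + conj (u * conj v)) := by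
        simp only [map_mul (starRingEnd ℂ), Complex.conj_conj]; ring
    _ = ((β * (u * conj v).re : ℝ) : ℂ) := by
        rw [hs, Complex.add_conj]; push_cast; ring

/-- **The pointwise identity**:
`F(U) F(ΘU) e^{-β S_Λ(U)} = e^{-βN#Λ'} · g(U) conj g(ΘU) · exp(∑ᵢ aᵢ(U) conj aᵢ(ΘU))` with
`g = F · e^{βA + βS_M/2}`. [folklore] -/
theorem integrand_eq (hij : i < j) (hρ : Continuous ρ) {β : ℝ} (hβ : 0 ≤ β) (L : ℕ)
    (F : ZdGaugeConfig 4 G → ℝ) (U : ZdGaugeConfig 4 G) :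
    (((F U * F (fun e : Site 4 × Fin 4 => U (e.1 ∘ Equiv.swap i j, Equiv.swap i j e.2))) * Real.exp
        (-β * zdWilsonAction ρ (box 4 L) U) : ℝ) : ℂ) =
      (Real.exp (-β * ((N : ℝ) * (plaquettesIn (box 4 L)).card)) : ℂ) *
        (((F U : ℂ) * (Real.exp (β * (∑ p ∈ (plaquettesIn (box 4 L)).filter (fun p : Site 4 × Fin 4
            × Fin 4 => ((p.1 j ≤ p.1 i ∧ (p.1 + Pi.single p.2.1 1 : Site 4) j ≤ (p.1 + Pi.single
            p.2.1 1 : Site 4) i ∧ (p.1 + Pi.single p.2.2 1 : Site 4) j ≤ (p.1 + Pi.single p.2.2 1 :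
            Site 4) i ∧ (p.1 + Pi.single p.2.1 1 + Pi.single p.2.2 1 : Site 4) j ≤ (p.1 + Pi.single
            p.2.1 1 + Pi.single p.2.2 1 : Site 4) i) ∧ ¬ (p.1 i = p.1 j ∧ (p.1 + Pi.single p.2.1 1 :
            Site 4) i = (p.1 + Pi.single p.2.1 1 : Site 4) j ∧ (p.1 + Pi.single p.2.2 1 : Site 4) i
            = (p.1 + Pi.single p.2.2 1 : Site 4) j))), (ρ (ZdGaugeConfig.plaquette U p.1 p.2.1
            p.2.2)).trace.re) + β / 2 * (∑ p ∈ (plaquettesIn (box 4 L)).filter (fun p : Site 4 × Fin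
            4 × Fin 4 => (p.1 i = p.1 j ∧ (p.1 + Pi.single p.2.1 1 : Site 4) i = (p.1 + Pi.single
            p.2.1 1 : Site 4) j ∧ (p.1 + Pi.single p.2.2 1 : Site 4) i = (p.1 + Pi.single p.2.2 1 :
            Site 4) j)), (ρ (ZdGaugeConfig.plaquette U p.1 p.2.1 p.2.2)).trace.re)) : ℂ)) * conj
            (((F ((fun e : Site 4 × Fin 4 => U (e.1 ∘ Equiv.swap i j, Equiv.swap i j e.2))) : ℂ) *
            (Real.exp (β * (∑ p ∈ (plaquettesIn (box 4 L)).filter (fun p : Site 4 × Fin 4 × Fin 4 =>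
            ((p.1 j ≤ p.1 i ∧ (p.1 + Pi.single p.2.1 1 : Site 4) j ≤ (p.1 + Pi.single p.2.1 1 : Site
            4) i ∧ (p.1 + Pi.single p.2.2 1 : Site 4) j ≤ (p.1 + Pi.single p.2.2 1 : Site 4) i ∧
            (p.1 + Pi.single p.2.1 1 + Pi.single p.2.2 1 : Site 4) j ≤ (p.1 + Pi.single p.2.1 1 +
            Pi.single p.2.2 1 : Site 4) i) ∧ ¬ (p.1 i = p.1 j ∧ (p.1 + Pi.single p.2.1 1 : Site 4) i
            = (p.1 + Pi.single p.2.1 1 : Site 4) j ∧ (p.1 + Pi.single p.2.2 1 : Site 4) i = (p.1 +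
            Pi.single p.2.2 1 : Site 4) j))), (ρ (ZdGaugeConfig.plaquette ((fun e : Site 4 × Fin 4
            => U (e.1 ∘ Equiv.swap i j, Equiv.swap i j e.2))) p.1 p.2.1 p.2.2)).trace.re) + β / 2 *
            (∑ p ∈ (plaquettesIn (box 4 L)).filter (fun p : Site 4 × Fin 4 × Fin 4 => (p.1 i = p.1 j
            ∧ (p.1 + Pi.single p.2.1 1 : Site 4) i = (p.1 + Pi.single p.2.1 1 : Site 4) j ∧ (p.1 +
            Pi.single p.2.2 1 : Site 4) i = (p.1 + Pi.single p.2.2 1 : Site 4) j)), (ρ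
            (ZdGaugeConfig.plaquette ((fun e : Site 4 × Fin 4 => U (e.1 ∘ Equiv.swap i j, Equiv.swap
            i j e.2))) p.1 p.2.1 p.2.2)).trace.re)) : ℂ))) *
          Complex.exp (∑ idx : (↥((plaquettesIn (box 4 L)).filter (fun p : Site 4 × Fin 4 × Fin 4 =>
              (p.2.1 = i ∧ p.2.2 = j ∧ p.1 i = p.1 j))) × Fin N × Fin N × Bool), ((Real.sqrt (β / 2)
              : ℂ) * (if idx.2.2.2 then
              Literature.RepresentationTheory.CompactGroups.CompactGroup.unitarize ρ hρ (U
              (idx.1.1.1, i) * U (idx.1.1.1 + Pi.single i 1, j)) idx.2.1 idx.2.2.1 else conj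
              (Literature.RepresentationTheory.CompactGroups.CompactGroup.unitarize ρ hρ (U
              (idx.1.1.1, i) * U (idx.1.1.1 + Pi.single i 1, j)) idx.2.1 idx.2.2.1))) * conj
              (((Real.sqrt (β / 2) : ℂ) * (if idx.2.2.2 then
              Literature.RepresentationTheory.CompactGroups.CompactGroup.unitarize ρ hρ (((fun e :
              Site 4 × Fin 4 => U (e.1 ∘ Equiv.swap i j, Equiv.swap i j e.2))) (idx.1.1.1, i) *
              ((fun e : Site 4 × Fin 4 => U (e.1 ∘ Equiv.swap i j, Equiv.swap i j e.2))) (idx.1.1.1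
              + Pi.single i 1, j)) idx.2.1 idx.2.2.1 else conj
              (Literature.RepresentationTheory.CompactGroups.CompactGroup.unitarize ρ hρ (((fun e :
              Site 4 × Fin 4 => U (e.1 ∘ Equiv.swap i j, Equiv.swap i j e.2))) (idx.1.1.1, i) *
              ((fun e : Site 4 × Fin 4 => U (e.1 ∘ Equiv.swap i j, Equiv.swap i j e.2))) (idx.1.1.1
              + Pi.single i 1, j)) idx.2.1 idx.2.2.1)))))) := by
  rw [sum_acoef_mul_conj ρ hρ hβ L U, zdWilsonAction_box_eq ρ L U, sum_plaqRe_split ρ hij hρ L U,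
    smir_swapCfg ρ hij hρ L U, ← Complex.ofReal_exp]
  generalize (∑ p ∈ (plaquettesIn (box 4 L)).filter (fun p : Site 4 × Fin 4 × Fin 4 => ((p.1 j ≤ p.1
      i ∧ (p.1 + Pi.single p.2.1 1 : Site 4) j ≤ (p.1 + Pi.single p.2.1 1 : Site 4) i ∧ (p.1 +
      Pi.single p.2.2 1 : Site 4) j ≤ (p.1 + Pi.single p.2.2 1 : Site 4) i ∧ (p.1 + Pi.single p.2.1
      1 + Pi.single p.2.2 1 : Site 4) j ≤ (p.1 + Pi.single p.2.1 1 + Pi.single p.2.2 1 : Site 4) i)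
      ∧ ¬ (p.1 i = p.1 j ∧ (p.1 + Pi.single p.2.1 1 : Site 4) i = (p.1 + Pi.single p.2.1 1 : Site 4)
      j ∧ (p.1 + Pi.single p.2.2 1 : Site 4) i = (p.1 + Pi.single p.2.2 1 : Site 4) j))), (ρ
      (ZdGaugeConfig.plaquette U p.1 p.2.1 p.2.2)).trace.re) = A₁
  generalize (∑ p ∈ (plaquettesIn (box 4 L)).filter (fun p : Site 4 × Fin 4 × Fin 4 => ((p.1 j ≤ p.1
      i ∧ (p.1 + Pi.single p.2.1 1 : Site 4) j ≤ (p.1 + Pi.single p.2.1 1 : Site 4) i ∧ (p.1 +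
      Pi.single p.2.2 1 : Site 4) j ≤ (p.1 + Pi.single p.2.2 1 : Site 4) i ∧ (p.1 + Pi.single p.2.1
      1 + Pi.single p.2.2 1 : Site 4) j ≤ (p.1 + Pi.single p.2.1 1 + Pi.single p.2.2 1 : Site 4) i)
      ∧ ¬ (p.1 i = p.1 j ∧ (p.1 + Pi.single p.2.1 1 : Site 4) i = (p.1 + Pi.single p.2.1 1 : Site 4)
      j ∧ (p.1 + Pi.single p.2.2 1 : Site 4) i = (p.1 + Pi.single p.2.2 1 : Site 4) j))), (ρ
      (ZdGaugeConfig.plaquette ((fun e : Site 4 × Fin 4 => U (e.1 ∘ Equiv.swap i j, Equiv.swap i j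
      e.2))) p.1 p.2.1 p.2.2)).trace.re) = A₂
  generalize (∑ p ∈ (plaquettesIn (box 4 L)).filter (fun p : Site 4 × Fin 4 × Fin 4 => (p.1 i = p.1
      j ∧ (p.1 + Pi.single p.2.1 1 : Site 4) i = (p.1 + Pi.single p.2.1 1 : Site 4) j ∧ (p.1 +
      Pi.single p.2.2 1 : Site 4) i = (p.1 + Pi.single p.2.2 1 : Site 4) j)), (ρ
      (ZdGaugeConfig.plaquette U p.1 p.2.1 p.2.2)).trace.re) = S
  generalize (∑ p ∈ (plaquettesIn (box 4 L)).filter (fun p : Site 4 × Fin 4 × Fin 4 => (p.2.1 = i ∧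
      p.2.2 = j ∧ p.1 i = p.1 j)), (ρ (ZdGaugeConfig.plaquette U p.1 p.2.1 p.2.2)).trace.re) = X
  simp only [map_mul, Complex.conj_ofReal]
  rw [show -β * ((N : ℝ) * (plaquettesIn (box 4 L)).card - (A₁ + A₂ + S + X)) =
      -β * ((N : ℝ) * (plaquettesIn (box 4 L)).card) + (β * A₁ + β / 2 * S) + (β * A₂ + β / 2 * S) +
        β * X by ring, Real.exp_add, Real.exp_add, Real.exp_add]
  push_cast
  ring

end Action

end SwapRP

/-- **Registered sub-goal `SwapReflectionPositivityAction`** (part 2/4 of stub `SwapReflectionPositivity`):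
the cut identity — for a plaquette `(y, i, j)` based on the mirror (`y i = y j`) the character of
its holonomy is the Gram kernel `∑_{a,b} Re (σ(V₊(U))_{ab} conj σ(V₊(ΘU))_{ab})` of the half plaquette
`V₊(U) = U(y, i) U(y + eᵢ, j)` in the unitarised representation `σ`. [folklore] -/
theorem SwapReflectionPositivityAction : ∀ {G : Type*} [Group G] [TopologicalSpace G] [IsTopologicalGroup G] [CompactSpace G] {N : ℕ} (ρ : G →* Matrix (Fin N) (Fin N) ℂ) (hρ : Continuous ρ) (i j : Fin 4) (U : Literature.MathematicalPhysics.QuantumFieldTheory.ZdGaugeConfig 4 G) (y : Literature.Probability.LatticeModels.Site 4), y i = y j → (ρ (Literature.MathematicalPhysics.QuantumFieldTheory.ZdGaugeConfig.plaquette U y i j)).trace.re = ∑ a, ∑ b, (Literature.RepresentationTheory.CompactGroups.CompactGroup.unitarize ρ hρ (U (y, i) * U (y + Pi.single i 1, j)) a b * (starRingEnd ℂ) (Literature.RepresentationTheory.CompactGroups.CompactGroup.unitarize ρ hρ (U (y ∘ Equiv.swap i j, Equiv.swap i j i) * U ((y + Pi.single i 1 : Literature.Probability.LatticeModels.Site 4)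 ∘ Equiv.swap i j, Equiv.swap i j j)) a b)).re := by
  intro G _ _ _ _ N ρ hρ i j U y hy
  exact SwapRP.re_tr_plaquette_cut ρ hρ U hy

end Summit.QuantumFields.YangMills.Theorems.CurvatureKernel

end
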